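import Summits.QuantumFields.YangMills.Theorems.SkewnessNonGeneration.Negative.MassiveGaussianFoil
import HarnessLib

/-!
# Route `ForcedResponseSkewness`, crux `ResponseLocalisation` (stmt-QuantumFields-24869): the tree-level one-contraction channel of
# `F² × F²` is the STRESS TENSOR (spin 2), never the scalar `F²` — kernel-checked algebra behind the «spin-2 channel» objection

Helper file (`--supports stmt-QuantumFields-24869 --as helper`; finite-dimensional algebra only) of the width prover `ym-line-frs-p3` (g5).  In the
tree's certified language for the free four-dimensional field-strength covariance (`SelfNormalisedSkewness.Negative.K h`: the `6 × 6` plane–plane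
matrix `⟨F_{μν}(w)F_{ρσ}(0)⟩ = −(h ⊙ δ)` built from the Hessian `h = ∇∇D(w)` of the propagator, symmetric and — in `d = 4`, `ΔD = 0` — TRACELESS;
`treeLevelSkewness_vanishes`: `tr K(h₁)K(h₂)K(h₃) = 0`), the ONE-contraction term of the operator product `F²(x) · F²(z)` is the quadratic form
`F(z)ᵀ K(h) F(z)` on the 2-form `F(z)`.  This file computes it:

* `planeSum_K_quadratic` — for symmetric `h` and antisymmetric `F`:  `Σ_{planes i,j} F_i K(h)_{ij} F_j = −Σ_{μρ} h_{μρ} (F Fᵀ)_{μρ}`;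
* `planeSum_K_quadratic_traceless` — if moreover `tr h = 0`:  `… = −Σ_{μρ} h_{μρ} θ(F)_{μρ}` with `θ(F)_{μρ} = (F Fᵀ)_{μρ} − ¼ δ_{μρ} Σ_{αβ}F_{αβ}²` the
  (Maxwell) STRESS TENSOR of `F` — a traceless symmetric, spin-2 object; the scalar `Σ F²` enters with coefficient `−tr h/4 = −ΔD/4 = 0`;
* (cited, not restated) `SkewnessNonGeneration.Negative.MassiveGaussianFoil.trace_K` — `tr K(h) = −3 tr h`: the quadratic form itself is traceless
  for harmonic `D` (no scalar projection).

Reading (evidence-24869-crux-spin2-channel.md): the tree-level OPE `dens(x)dens(z)` has NO `dens(z)` term (the integrated «contact coefficient» of the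
instrument p598136 vanishes at tree level, = the ring identity) but DOES have the spin-2 term `θ_{μρ}(z)·∂μ∂ρD(x−z)`, whose coefficient is a d-wave
Calderón–Zygmund kernel `≍ ḡ²Y₂(ŵ)/|w|⁴`; with `⟨θ_{μρ}(z)·dens(y)⟩ ≠ 0` in the interacting theory (conservation + trace anomaly) this puts a CZ piece into
the response profile `respM`, harmless for SIGNED smooth collar sums (sphere cancellation, `…LatticeCalculus`, p610949) and fatal for per-site ABSOLUTE collar
sums uniformly over `L¹`-normalised sources.  Nothing here is asserted about Yang–Mills; no summit is proved (conditional rung line, leaf R2a `BalabanLadder.NT`;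
the YM mass gap is NOT proved).
-/

namespace Summit.QuantumFields.YangMills.Cruxes.ResponseLocalisation.TensorChannel

open Matrix
open Summit.QuantumFields.YangMills.Theorems.SelfNormalisedSkewness.Negative

/-- **The one-contraction channel of `F² × F²` is `−⟪h, F Fᵀ⟫`.**  For a symmetric Hessian `h` and an antisymmetric field strength `F`,
`Σ_{i,j ∈ planes} F_{p1 i, p2 i} · K(h)_{ij} · F_{p1 j, p2 j} = −Σ_{μ,ρ} h_{μρ} Σ_α F_{μα} F_{ρα}`. [folklore] -/
theorem planeSum_K_quadratic (h F : Matrix (Fin 4) (Fin 4) ℝ) (hs : h.IsSymm) (hF : ∀ μ ν, F ν μ = -F μ ν) :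
    ∑ i : Fin 6, ∑ j : Fin 6, F (p1 i) (p2 i) * K h i j * F (p1 j) (p2 j) =
      -∑ μ : Fin 4, ∑ ρ : Fin 4, h μ ρ * ∑ α : Fin 4, F μ α * F ρ α := by
  have h10 := hs.apply 0 1; have h20 := hs.apply 0 2; have h30 := hs.apply 0 3
  have h21 := hs.apply 1 2; have h31 := hs.apply 1 3; have h32 := hs.apply 2 3
  have f00 : F 0 0 = 0 := by have := hF 0 0; linarith
  have f11 : F 1 1 = 0 := by have := hF 1 1; linarith
  have f22 : F 2 2 = 0 := by have := hF 2 2; linarith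
  have f33 : F 3 3 = 0 := by have := hF 3 3; linarith
  have f10 := hF 0 1; have f20 := hF 0 2; have f30 := hF 0 3
  have f21 := hF 1 2; have f31 := hF 1 3; have f32 := hF 2 3
  simp +decide [Fin.sum_univ_succ, K, p1, p2, δ, h10, h20, h30, h21, h31, h32, f00, f11, f22, f33, f10, f20, f30, f21,
    f31, f32]
  ring

/-- **Traceless Hessian ⇒ pure stress-tensor channel.**  If moreover `tr h = 0` (harmonic propagator, `d = 4`), the quadratic form is
`−Σ_{μρ} h_{μρ} θ(F)_{μρ}` with `θ(F)_{μρ} = Σ_α F_{μα}F_{ρα} − ¼δ_{μρ}Σ_{αβ}F_{αβ}²` the traceless symmetric (spin-2) stress tensor of `F`: the scalar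
`Σ F²` appears with coefficient `−tr h/4 = 0`. [folklore] -/
theorem planeSum_K_quadratic_traceless (h F : Matrix (Fin 4) (Fin 4) ℝ) (hs : h.IsSymm) (ht : h.trace = 0)
    (hF : ∀ μ ν, F ν μ = -F μ ν) :
    ∑ i : Fin 6, ∑ j : Fin 6, F (p1 i) (p2 i) * K h i j * F (p1 j) (p2 j) =
      -∑ μ : Fin 4, ∑ ρ : Fin 4, h μ ρ *
        (∑ α : Fin 4, F μ α * F ρ α - (if μ = ρ then (1 / 4 : ℝ) * ∑ α : Fin 4, ∑ β : Fin 4, F α β ^ 2 else 0)) := by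
  rw [planeSum_K_quadratic h F hs hF]
  have ht' : h 0 0 + h 1 1 + h 2 2 + h 3 3 = 0 := by
    simpa [Matrix.trace, Fin.sum_univ_four] using ht
  have key : ∑ μ : Fin 4, ∑ ρ : Fin 4, h μ ρ * (if μ = ρ then (1 / 4 : ℝ) * ∑ α : Fin 4, ∑ β : Fin 4, F α β ^ 2 else 0) = 0 := by
    simp only [mul_ite, mul_zero, Finset.sum_ite_eq, Finset.mem_univ, if_true]
    rw [← Finset.sum_mul]
    simp [Fin.sum_univ_four, ht']
  simp only [mul_sub, Finset.sum_sub_distrib, key, sub_zero]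

end Summit.QuantumFields.YangMills.Cruxes.ResponseLocalisation.TensorChannel
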